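import Summits.QuantumFields.BalabanUV.Beta.SpineRecursiveT2AllSockets
import Summits.QuantumFields.BalabanUV.Beta.ColourBasisSU

/-!
# `BalabanUV.Beta.SpineRecursiveT2AllSocketsSU` — binder row D1, (L4): the `SU(N)` instance (`N ≥ 2`) of
# `SpineRecursiveT2AllSockets.…_of_an1_letters` with NO colour hypothesis — the orthonormal complete traceless basis is an3-g32's
# `ColourBasisSU.suGen N` (`suGen_complete`, `suGen_trOrthonormal`, colour `diagIndex`) (β sub-cell, row BETA-an2 = BINDER-OWNERS row D1
# OWNER, lineage an2 gen 19)

HONEST FRAMING (cell charter, verbatim): «discharging BetaPertH makes Balaban's UV stability UNCONDITIONAL — a real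
constructive-QFT result; it is NOT the continuum limit and NOT the Clay problem.»  DERIVED cell leaf (wiring, [folklore]); no statement of
Bałaban's papers, no `[cite:]`, no `def`, no `Prop` fact.  an1's two letters remain hypotheses.  NOT D1, NOT `BetaPertH`, NOT continuum, NOT Clay.
Provenance: β sub-cell, unit beta-an2 gen 19, 2026-08-20 (v1); no existing file touched.
-/

open Finset
open scoped BigOperators
open Literature.MathematicalPhysics.QuantumFieldTheory
open Literature.MathematicalPhysics.QuantumFieldTheory.Balaban1983to89
open Literature.MathematicalPhysics.QuantumFieldTheory.Balaban1983to89.Beta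
open ExpKernelCalculus (MKer Decays BiLoc comp tadpole VertexFamily VertexFamily₂ shiftK)
open AffineAveraging (box toSite)
open AveragingContoursRooted (ctr ctrOff ctrOff_mem_box)
open AveragingMixedJetTables (mixFFAt)
open PolarizationSign (reflSign AxisReflectionCovariant)
open KernelReflection (refK refK_apply)
open ResolventReflection (bref Φ)
open OneStepResolventKernel (Fib LocStencil JetData wsum)
open OneStepKernelFamily (KInvStep colH vertexOfK TbalOf flipK)
open WilsonVertex2Sym (wsym22)
open BalabanStepJetsSucc (wE wVH mmRead)
open BalabanCompositeJets (LocStencil₂)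
open BalabanStepW2 (M2Of wV4 wB2)
open SecondOrderResponse (dM W2OfK W2SymOfK LocStencilFM vertex2OfK mixOfK K2OfK)
open Summit.QuantumFields.BalabanUV.Beta.TameKernelCalculus
open Summit.QuantumFields.BalabanUV.Beta.ChartConjugation (conjV conjW)
open Summit.QuantumFields.BalabanUV.Beta.AxialDressingRooted (coDressKBmAt)
open Summit.QuantumFields.BalabanUV.Beta.BorderedHessian (diagK ctGen bhKStepAt stepScale sgnK)
open Summit.QuantumFields.BalabanUV.Beta.MixedJetTablesPlug (hmix_an1)
open Summit.QuantumFields.BalabanUV.Beta.ColourBasisSU (suGen suGen_complete suGen_trOrthonormal diagIndex ne_zero_of_two_le)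

noncomputable section

namespace Summit.QuantumFields.BalabanUV.Beta.SpineRooted

section Wall

variable {Lc : ℕ} [NeZero Lc]

/-- [folklore] **THE `SU(N)` INSTANCE, `N ≥ 2`** (colour basis := an3's `ColourBasisSU.suGen N`, colour := `diagIndex`). -/
theorem axisReflectionCovariant_flipK_TbalOf_JsRecWAtOf_of_an1_letters_suN (hLc : Odd Lc) {N : ℕ} (hN : 2 ≤ N) (cΛ cE₂ cB : ℝ)
    {vh₂S : Fin 4 → (Fin 4 → ℤ) → Fin 4 → (Fin 4 → ℤ) → MKer 4 (Fib 3)} (hB : ∃ C δ : ℝ, 0 < δ ∧ LocStencil₂ vh₂S C δ)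
    (hB0 : ∀ κ u κ' u' (x z : Fin 4 → ℤ) (β β' : Fin 4), vh₂S κ u κ' u' x z (Sum.inl β) (Sum.inl β') = 0)
    (γ : ℕ → ℝ) (hγ : ∀ j, γ j = -((Lc : ℝ) ^ 8 / 2) * wVH 3 Lc j / (stepScale 3 Lc j * (Lc : ℝ) ^ 4))
    (hlock2 : ∀ j, cE₂ * wV4 3 Lc (j + 1) * wVH 3 Lc (j + 1) = ((Lc : ℝ) ^ 4 * wE 3 Lc (j + 1)) ^ 2)
    (RM : ℕ → Fin 4 → Fin 4 → (Fin 4 → ℤ) → Fin 4 → (Fin 4 → ℤ) → MKer 4 (Fib 3))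
    -- (hM2) THE MIXED LETTER ∀ j
    (hM2 : ∀ (j : ℕ) (α κ : Fin 4) (u : Fin 4 → ℤ) (ρ : Fin 4) (w : Fin 4 → ℤ),
      M2Of 3 Lc (mixFFAt (toSite (ctrOff 4 Lc)) Lc) j κ (bref α κ u) ρ (bref α ρ w) =
        (reflSign α κ * reflSign α ρ) • refK (Φ Lc α)
          (M2Of 3 Lc (mixFFAt (toSite (ctrOff 4 Lc)) Lc) j κ u ρ w + conjV (M1At 3 Lc (toSite (ctrOff 4 Lc)) cΛ j ρ w) (diagK fun p c => γ j * ctGen 3 α Lc κ u p c) +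
            RM j α κ u ρ w))
    (hRMc : ∀ (j : ℕ) (α : Fin 4), ∃ C δ : ℝ, 0 < δ ∧ LocStencilFM Lc (RM j α) C δ)
    (hRMp : ∀ (j : ℕ) (α : Fin 4) κ u ρ w, trK (RM j α κ u ρ w) = -sgnK (RM j α κ u ρ w))
    -- THE BORDER TABLE IS ANTI-TWIN (parity-even) WITH NO mm BLOCK, AND ITS LETTER IS ONE EXACT fm-LAW ∀ j ≥ 0 (X-an2-46)
    (hBat : ∀ κ u κ' u' (x z : Fin 4 → ℤ) (β m : Fin 4), vh₂S κ u κ' u' z x (Sum.inr m) (Sum.inl β) = -vh₂S κ u κ' u' x z (Sum.inl β) (Sum.inr m))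
    (hBmm0 : ∀ κ u κ' u' (x z : Fin 4 → ℤ) (m m' : Fin 4), vh₂S κ u κ' u' x z (Sum.inr m) (Sum.inr m') = 0)
    (hBe : ∀ (j : ℕ) (α : Fin 4) κ u κ' u' (x z : Fin 4 → ℤ) (β m : Fin 4),
      ((cB * wB2 3 Lc j) • vh₂S κ (bref α κ u) κ' (bref α κ' u')) x z (Sum.inl β) (Sum.inr m) =
        ((reflSign α κ * reflSign α κ') • refK (Φ Lc α) ((cB * wB2 3 Lc j) • vh₂S κ u κ' u' +
          conjW (bhKStepAt 3 (toSite (ctrOff 4 Lc)) Lc j)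
            (SpureRecAt 3 Lc (toSite (ctrOff 4 Lc)) ((Lc : ℝ) ^ 4) (-((Lc : ℝ) ^ 8 / 2)) cΛ j κ u)
            (SpureRecAt 3 Lc (toSite (ctrOff 4 Lc)) ((Lc : ℝ) ^ 4) (-((Lc : ℝ) ^ 8 / 2)) cΛ j κ' u')
            (diagK fun p c => γ j * ctGen 3 α Lc κ u p c) (diagK fun p c => γ j * ctGen 3 α Lc κ' u' p c)
            (diagK fun p c => γ j ^ 2 * (ctGen 3 α Lc κ u p c * ctGen 3 α Lc κ' u' p c)))) x z (Sum.inl β) (Sum.inr m))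
    (hBt : ∀ (κ : Fin 4) (u : Fin 4 → ℤ) (κ' : Fin 4) (u' t : Fin 4 → ℤ),
      vh₂S κ (u + (Lc : ℤ) • t) κ' (u' + (Lc : ℤ) • t) = shiftK (-((Lc : ℤ) • t)) (vh₂S κ u κ' u'))
    :
    ∀ j : ℕ, AxisReflectionCovariant
      (flipK (TbalOf Lc (JsRecWAtOf (d := 3) hLc.pos (ctrOff_mem_box hLc.pos) ((Lc : ℝ) ^ 4) (-((Lc : ℝ) ^ 8 / 2)) cΛ cE₂ cB ((8 * (N : ℝ) ^ 2)⁻¹ • wsym22 N) hB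
        (hmix_an1 (d := 3) hLc.pos (ctrOff_mem_box hLc.pos))) j)) :=
  axisReflectionCovariant_flipK_TbalOf_JsRecWAtOf_of_an1_letters hLc (suGen_complete (ne_zero_of_two_le hN)) (suGen_trOrthonormal N)
    (ne_zero_of_two_le hN) (diagIndex hN) cΛ cE₂ cB hB hB0 γ hγ hlock2 RM hM2 hRMc hRMp hBat hBmm0 hBe hBt

end Wall

end Summit.QuantumFields.BalabanUV.Beta.SpineRooted

end
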